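import Summits.KontsevichZagierPeriods.KontsevichZagierPeriods.Theorems.GpcZeta4Eq4zeta31.Negative.LoadBearing
import Summits.KontsevichZagierPeriods.KontsevichZagierPeriods.Theorems.GpcZeta4Eq4zeta31.Negative.ToricNormalForm

/-!
# `GpcZeta4Eq4zeta31` (stmt-KontsevichZagierPeriods-0275): negative side — invariant-set scissors and the
# corner pattern

Cdisprove unit of the crux `GpcZeta4Eq4zeta31` (route `Grothendieck`). GENERAL PRINCIPLE (§1): for any
family of measurable test sets `U n ⊆ ℝⁿ`, the window evaluation `[σ, f] ↦ ∫_{σ ∩ U} f` is additive and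
invariant under every change of variables `Φ` that PRESERVES `U` on the domain (`x ∈ U ↔ Φ x ∈ U`;
Jacobian formula on `σ ∩ U`), so it kills the sub-calculus
`invScissors U = closure (domainAdd ∪ integrandAdd ∪ invCovRel U)` (`invScissors_le_ker_windowEval`).
Consequently a move chain for the crux must contain, for EVERY `U` with
`∫_{Δ₄ ∩ U} (ω₀₀₀₁ − 4ω₀₀₁₁) ≠ 0`, a substitution that does not preserve `U` (or a Newton–Leibniz move).
THE CORNER PATTERN (§2): `cornerWin n = {all coordinates in (δ', δ) ∪ (1−δ, 1−δ')}`, `δ = 10⁻⁶`,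
`δ' = 9·10⁻⁷`, is invariant under the whole hyperoctahedral group (coordinate permutations,
`comp_perm_mem_cornerWin_iff`, and reflections `tᵢ ↦ 1 − tᵢ`, `flipMap_mem_cornerWin_iff`) and has volume
`≤ (2(δ−δ'))ⁿ`. The evaluation on the target and the hyperoctahedral corollary are in
`CornerInvariant.lean`.

Sources: M. Kontsevich, D. Zagier, *Periods* (2001), §1.2 rules (1), (2).
-/

noncomputable section

namespace Summit.KontsevichZagierPeriods.GpcZeta4Eq4zeta31.Negative

open Set MeasureTheory
open Literature.NumberTheory.Transcendental
open Literature.NumberTheory.Transcendental.KZ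
open Summit.KontsevichZagierPeriods.KontsevichZagierPeriods.Theses.Grothendieck (GpcZeta4Eq4zeta31)
open Summit.KontsevichZagierPeriods.MzvKernelInKZ.Negative
open Summit.KontsevichZagierPeriods.HoffmanRelationInKZ.Negative
  (window window_eq_pi isOpen_window measurableSet_window windowEval windowEval_of addOnly
    addOnly_le_ker_windowEval setIntegral_pos_of_pos_on)

/-! ## §1 Invariant-set scissors: changes of variables preserving a test family `U` -/

section InvScissors

/-- **Move set: changes of variables PRESERVING a family of test sets** `U n ⊆ ℝⁿ` (`x ∈ U ↔ Φ x ∈ U` on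
the domain). Semialgebraicity of `Φ` is not even required — the move set is larger than its
intersection with `changeOfVariablesRel`, which only strengthens the negative results below. -/
def invCovRel (U : (n : ℕ) → Set (Fin n → ℝ)) : Set FormalRep :=
  {c | ∃ (n : ℕ) (r r' : IntegralRep n) (Φ : (Fin n → ℝ) → (Fin n → ℝ))
      (Φ' : (Fin n → ℝ) → (Fin n → ℝ) →L[ℝ] (Fin n → ℝ)),
    (∀ x ∈ r.domain, HasFDerivWithinAt Φ (Φ' x) r.domain x) ∧ InjOn Φ r.domain ∧
    r'.domain = Φ '' r.domain ∧ (∀ x ∈ r.domain, r.integrand x = r'.integrand (Φ x) * |(Φ' x).det|) ∧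
    (∀ x ∈ r.domain, x ∈ U n ↔ Φ x ∈ U n) ∧ c = of r - of r'}

/-- The sub-calculus of dissections, integrand additivity and `U`-preserving changes of variables. -/
def invScissors (U : (n : ℕ) → Set (Fin n → ℝ)) : AddSubgroup FormalRep :=
  AddSubgroup.closure (domainAddRel ∪ integrandAddRel ∪ invCovRel U)

/-- A `U`-preserving map carries `σ ∩ U` onto `Φ(σ) ∩ U`. [folklore] -/
theorem image_inter_eq_of_preserves {n : ℕ} {σ : Set (Fin n → ℝ)} {V : Set (Fin n → ℝ)}
    {Φ : (Fin n → ℝ) → (Fin n → ℝ)} (hU : ∀ x ∈ σ, x ∈ V ↔ Φ x ∈ V) :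
    Φ '' (σ ∩ V) = Φ '' σ ∩ V := by
  ext y
  constructor
  · rintro ⟨x, ⟨hx, hxV⟩, rfl⟩
    exact ⟨⟨x, hx, rfl⟩, (hU x hx).1 hxV⟩
  · rintro ⟨⟨x, hx, rfl⟩, hyV⟩
    exact ⟨x, ⟨hx, (hU x hx).2 hyV⟩, rfl⟩

/-- **Window evaluation on `U` is invariant under `U`-preserving changes of variables** (Jacobian
formula on `σ ∩ U`). [folklore] -/
theorem windowEval_eq_zero_of_mem_invCovRel {U : (n : ℕ) → Set (Fin n → ℝ)} (hU : ∀ n, MeasurableSet (U n))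
    {c : FormalRep} (hc : c ∈ invCovRel U) : windowEval U c = 0 := by
  obtain ⟨n, r, r', Φ, Φ', hderiv, hinj, hdom, hint, hpres, rfl⟩ := hc
  rw [map_sub, windowEval_of, windowEval_of, sub_eq_zero]
  have hmeas : MeasurableSet (r.domain ∩ U n) := (IntegralRep.measurableSet_domain_holds r).inter (hU n)
  have hset : r'.domain ∩ U n = Φ '' (r.domain ∩ U n) := by
    rw [hdom, image_inter_eq_of_preserves hpres]
  rw [hset, integral_image_eq_integral_abs_det_fderiv_smul volume hmeas
    (fun x hx => (hderiv x hx.1).mono inter_subset_left) (hinj.mono inter_subset_left)]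
  refine setIntegral_congr_fun hmeas fun x hx => ?_
  rw [hint x hx.1, smul_eq_mul, mul_comm]

/-- **Window evaluation on `U` kills the whole `U`-scissors sub-calculus.** [folklore] -/
theorem invScissors_le_ker_windowEval {U : (n : ℕ) → Set (Fin n → ℝ)} (hU : ∀ n, MeasurableSet (U n)) :
    invScissors U ≤ (windowEval U).ker := by
  refine (AddSubgroup.closure_le _).mpr ?_
  rintro c (hc | hc)
  · exact addOnly_le_ker_windowEval hU (AddSubgroup.subset_closure hc)
  · exact (AddMonoidHom.mem_ker).2 (windowEval_eq_zero_of_mem_invCovRel hU hc)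

/-- `U`-scissors is part of `KZ.relations` as soon as the maps are `ℚ`-semialgebraic; stated for the
semialgebraic sub-move-set. [folklore] -/
theorem invCovRel_semialg_subset_changeOfVariablesRel (U : (n : ℕ) → Set (Fin n → ℝ)) :
    {c | ∃ (n : ℕ) (r r' : IntegralRep n) (Φ : (Fin n → ℝ) → (Fin n → ℝ))
      (Φ' : (Fin n → ℝ) → (Fin n → ℝ) →L[ℝ] (Fin n → ℝ)),
      IsSemialgebraicMapOn ℚ r.domain Φ ∧
      (∀ x ∈ r.domain, HasFDerivWithinAt Φ (Φ' x) r.domain x) ∧ InjOn Φ r.domain ∧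
      r'.domain = Φ '' r.domain ∧ (∀ x ∈ r.domain, r.integrand x = r'.integrand (Φ x) * |(Φ' x).det|) ∧
      (∀ x ∈ r.domain, x ∈ U n ↔ Φ x ∈ U n) ∧ c = of r - of r'} ⊆ changeOfVariablesRel ∩ invCovRel U := by
  rintro c ⟨n, r, r', Φ, Φ', hsa, hderiv, hinj, hdom, hint, hpres, rfl⟩
  exact ⟨⟨n, r, r', Φ, Φ', hsa, hderiv, hinj, hdom, hint, rfl⟩, ⟨n, r, r', Φ, Φ', hderiv, hinj, hdom, hint, hpres, rfl⟩⟩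

end InvScissors

/-! ## §2 The corner pattern `U = {all coordinates within (δ', δ) of 0 or of 1}` -/

section Corner

/-- Outer radius of the corner pattern. -/
def δ : ℝ := ((1 / 1000000 : ℚ) : ℝ)
/-- Inner radius of the corner pattern. -/
def δ' : ℝ := ((9 / 10000000 : ℚ) : ℝ)

/-- `δ = 10⁻⁶`. [folklore] -/
theorem δ_eq : δ = 1 / 1000000 := by rw [δ]; push_cast; ring
/-- `δ' = 9·10⁻⁷`. [folklore] -/
theorem δ'_eq : δ' = 9 / 10000000 := by rw [δ']; push_cast; ring

/-- The one-dimensional pattern: near `0` or near `1`, symmetrically. -/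
def nearEnds : Set ℝ := Ioo δ' δ ∪ Ioo (1 - δ) (1 - δ')

/-- The one-dimensional pattern is measurable. [folklore] -/
theorem measurableSet_nearEnds : MeasurableSet nearEnds := measurableSet_Ioo.union measurableSet_Ioo

/-- `nearEnds` is symmetric under `t ↦ 1 − t`. [folklore] -/
theorem one_sub_mem_nearEnds {t : ℝ} : 1 - t ∈ nearEnds ↔ t ∈ nearEnds := by
  simp only [nearEnds, mem_union, mem_Ioo]
  constructor
  · rintro (⟨h1, h2⟩ | ⟨h1, h2⟩)
    · right; constructor <;> linarith
    · left; constructor <;> linarith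
  · rintro (⟨h1, h2⟩ | ⟨h1, h2⟩)
    · right; constructor <;> linarith
    · left; constructor <;> linarith

/-- **The corner pattern** in every dimension: all coordinates in `nearEnds`. It is invariant under
coordinate permutations and under the reflections `tᵢ ↦ 1 − tᵢ` (the hyperoctahedral group). -/
def cornerWin (n : ℕ) : Set (Fin n → ℝ) := {x | ∀ i, x i ∈ nearEnds}

/-- The corner pattern is a product set. [folklore] -/
theorem cornerWin_eq_pi (n : ℕ) : cornerWin n = Set.pi univ fun _ : Fin n => nearEnds := by
  ext x; simp [cornerWin]

/-- The corner pattern is measurable. [folklore] -/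
theorem measurableSet_cornerWin (n : ℕ) : MeasurableSet (cornerWin n) := by
  rw [cornerWin_eq_pi]
  exact MeasurableSet.univ_pi fun _ => measurableSet_nearEnds

/-- Reflections of coordinates preserve the corner pattern. [folklore] -/
theorem flipMap_mem_cornerWin_iff {n : ℕ} (ε : Fin n → Bool) (x : Fin n → ℝ) :
    x ∈ cornerWin n ↔ flipMap ε x ∈ cornerWin n := by
  simp only [cornerWin, mem_setOf_eq, flipMap_apply]
  refine forall_congr' fun i => ?_
  split_ifs
  · exact one_sub_mem_nearEnds.symm
  · exact Iff.rfl

/-- Coordinate permutations preserve the corner pattern. [folklore] -/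
theorem comp_perm_mem_cornerWin_iff {n : ℕ} (σ : Equiv.Perm (Fin n)) (x : Fin n → ℝ) :
    x ∈ cornerWin n ↔ (x ∘ σ) ∈ cornerWin n := by
  simp only [cornerWin, mem_setOf_eq, Function.comp_apply]
  constructor
  · intro h i; exact h (σ i)
  · intro h i; simpa using h (σ.symm i)

/-- The volume of the corner pattern is at most `(2(δ − δ'))ⁿ`. [folklore] -/
theorem volume_cornerWin_le (n : ℕ) : volume (cornerWin n) ≤ ENNReal.ofReal (2 * (δ - δ')) ^ n := by
  rw [cornerWin_eq_pi, volume_pi_pi]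
  have h1 : volume nearEnds ≤ ENNReal.ofReal (2 * (δ - δ')) := by
    calc volume nearEnds ≤ volume (Ioo δ' δ) + volume (Ioo (1 - δ) (1 - δ')) := measure_union_le _ _
      _ = ENNReal.ofReal (2 * (δ - δ')) := by
        rw [Real.volume_Ioo, Real.volume_Ioo, ← ENNReal.ofReal_add (by rw [δ_eq, δ'_eq]; norm_num)
          (by rw [δ_eq, δ'_eq]; norm_num)]
        congr 1; ring
  calc ∏ _i : Fin n, volume nearEnds ≤ ∏ _i : Fin n, ENNReal.ofReal (2 * (δ - δ')) :=
        Finset.prod_le_prod' fun i _ => h1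
    _ = ENNReal.ofReal (2 * (δ - δ')) ^ n := by rw [Finset.prod_const, Finset.card_univ, Fintype.card_fin]

end Corner

end Summit.KontsevichZagierPeriods.GpcZeta4Eq4zeta31.Negative
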